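import Summits.RiemannHypothesis.RiemannHypothesis.Theorems.SemilocalSoninMollifyWeil
import Summits.RiemannHypothesis.RiemannHypothesis.Theorems.SoninDistanceOne
import HarnessLib

/-!
# The semilocal operator obligation at `S = {∞, 2}`: the certificate bridge with every analytic hypothesis discharged

Cell `rh-explicit`, seat cc-s2-1 (HOME `run/shared/lean/pub/rh-explicit/`; lead ruling R5-1).  One theorem:
`not_semilocalSoninIneqOn_two_of_bdd_witness_one` = `not_semilocalSoninIneqOn_two_of_bdd_witness`
(`SemilocalSoninMollifyWeil`) with the band-energy hypothesis `hband` closed by the tree's constant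
`Λ = 9999428/10⁷` (`BandEnergy.integral_norm_sq_fourier_Icc_le`, seat cc-s2-3, through
`SoninDistance.band_energy_bound_Lp_of_fun`).  What a finite certificate against `SemilocalSoninIneqOn 2 a` must now
supply is exactly: a bounded measurable a.e.-continuous `G` vanishing off `[−b, b]` (`0 ≤ b < a`, `b < log 2`) with
finite archimedean energy and CC's two moment conditions; an a.e.-even `η ∈ L²(ℝ)` vanishing a.e. on `[−1, 1]`; and
real numbers `ε, d, B, Gm, N, C, K` with
`∫_{[−1,1]}|𝓕η|² ≤ ε`, `ε/(1 − 9999428/10⁷) ≤ d²`, `0 ≤ d < ‖η‖`, `B ≤ Re⟨η|ϑ(T_2(G⋆G̃))η⟩`, `‖θ_2η‖² ≤ Gm`,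
`‖η‖ ≤ N`, `‖T_2(G⋆G̃)‖₁ < K`, `0 ≤ C`, `(log 2/√2)D_{log 2}(G) + ∫₀^∞ w D(G) − C₂‖G‖₂² < C`, and
`C·(Gm + 4(2N + d)d) < B − K(2N + d)d`.

Proof-only file (no definitions, no named facts). [folklore]
-/

set_option linter.dupNamespace false  -- the mandated namespace repeats `RiemannHypothesis`

noncomputable section

open MeasureTheory Complex Set Filter Topology FourierTransform
open scoped Real ComplexConjugate ENNReal

namespace Summit.RiemannHypothesis.RiemannHypothesis

open Literature.NumberTheory.LFunctions Literature.NumberTheory.LFunctions.WeilContinuous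
  Literature.NumberTheory.ConnesConsani2021
  Summit.RiemannHypothesis.RiemannHypothesis.Theorems.MotivicDoor.SemilocalMarkov

/-- **Refutation of `SemilocalSoninIneqOn 2 a` from closed-form certificate data, no analytic hypothesis left**
(see the module docstring for the data list; `C₂ = semilocalTwoConstant`, `D = weilIncrement`,
`w = weilArchDensity`, `T_2 = twistKernel 2`, `θ_2 = primeTwist 2`). [folklore] -/
theorem not_semilocalSoninIneqOn_two_of_bdd_witness_one {G : ℝ → ℂ} {b M a : ℝ}
    (hGm : Measurable G) (hM : ∀ x, ‖G x‖ ≤ M) (hGb : ∀ x, b < |x| → G x = 0)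
    (hb : 0 ≤ b) (hab : b < a) (hb2 : b < Real.log 2) (hGc : ∀ᵐ x : ℝ, ContinuousAt G x)
    (hfin : IntegrableOn (fun t ↦ weilArchDensity t * weilIncrement G t) (Ioi 0))
    (h1 : mulFourier G (I / 2) = 0) (h0 : mulFourier G 0 = 0)
    {η : Lp ℂ 2 (volume : Measure ℝ)} (hev : η ∈ evenPart) (hvan : η ∈ vanishOn 1)
    {ε d B Gm N C K : ℝ}
    (hε : ∫ x in Icc (-1 : ℝ) 1, ‖((𝓕 η : Lp ℂ 2 (volume : Measure ℝ)) : ℝ → ℂ) x‖ ^ 2 ≤ ε)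
    (hdε : ε / (1 - 9999428 / 10000000) ≤ d ^ 2) (hd0 : 0 ≤ d) (hdη : d < ‖η‖)
    (hB : B ≤ (soninTraceForm (twistKernel 2 (weilConv G (weilReflect G))) (η : ℝ → ℂ)).re)
    (hG : ‖primeTwist 2 η‖ ^ 2 ≤ Gm) (hN : ‖η‖ ≤ N)
    (hC : Real.log 2 / Real.sqrt 2 * weilIncrement G (Real.log 2) +
        (∫ t in Ioi (0 : ℝ), weilArchDensity t * weilIncrement G t) -
        semilocalTwoConstant * ∫ x : ℝ, ‖G x‖ ^ 2 < C) (hC0 : 0 ≤ C)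
    (hK : ∫ τ, ‖twistKernel 2 (weilConv G (weilReflect G)) τ‖ < K)
    (hineq : C * (Gm + 4 * ((2 * N + d) * d)) < B - K * ((2 * N + d) * d)) :
    ¬ SemilocalSoninIneqOn 2 a :=
  not_semilocalSoninIneqOn_two_of_bdd_witness hGm hM hGb hb hab hb2 hGc hfin h1 h0 hev hvan
    (Λ := 9999428 / 10000000) (by norm_num) (by norm_num)
    (fun f hf => SoninDistance.band_energy_bound_Lp_of_fun (α := 1) (β := 1)
      (fun g hg hg0 => BandEnergy.integral_norm_sq_fourier_Icc_le hg hg0) f hf)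
    hε hdε hd0 hdη hB hG hN hC hC0 hK hineq

/-- **Monotone form**: under the same data, the obligation fails on EVERY window `a' ≥ a`
(`SemilocalSoninIneqOn.mono`). [folklore] -/
theorem not_semilocalSoninIneqOn_two_of_bdd_witness_one_of_le {G : ℝ → ℂ} {b M a a' : ℝ}
    (hGm : Measurable G) (hM : ∀ x, ‖G x‖ ≤ M) (hGb : ∀ x, b < |x| → G x = 0)
    (hb : 0 ≤ b) (hab : b < a) (hb2 : b < Real.log 2) (hGc : ∀ᵐ x : ℝ, ContinuousAt G x)
    (hfin : IntegrableOn (fun t ↦ weilArchDensity t * weilIncrement G t) (Ioi 0))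
    (h1 : mulFourier G (I / 2) = 0) (h0 : mulFourier G 0 = 0)
    {η : Lp ℂ 2 (volume : Measure ℝ)} (hev : η ∈ evenPart) (hvan : η ∈ vanishOn 1)
    {ε d B Gm N C K : ℝ}
    (hε : ∫ x in Icc (-1 : ℝ) 1, ‖((𝓕 η : Lp ℂ 2 (volume : Measure ℝ)) : ℝ → ℂ) x‖ ^ 2 ≤ ε)
    (hdε : ε / (1 - 9999428 / 10000000) ≤ d ^ 2) (hd0 : 0 ≤ d) (hdη : d < ‖η‖)
    (hB : B ≤ (soninTraceForm (twistKernel 2 (weilConv G (weilReflect G))) (η : ℝ → ℂ)).re)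
    (hG : ‖primeTwist 2 η‖ ^ 2 ≤ Gm) (hN : ‖η‖ ≤ N)
    (hC : Real.log 2 / Real.sqrt 2 * weilIncrement G (Real.log 2) +
        (∫ t in Ioi (0 : ℝ), weilArchDensity t * weilIncrement G t) -
        semilocalTwoConstant * ∫ x : ℝ, ‖G x‖ ^ 2 < C) (hC0 : 0 ≤ C)
    (hK : ∫ τ, ‖twistKernel 2 (weilConv G (weilReflect G)) τ‖ < K)
    (hineq : C * (Gm + 4 * ((2 * N + d) * d)) < B - K * ((2 * N + d) * d)) (haa' : a ≤ a') :
    ¬ SemilocalSoninIneqOn 2 a' := fun h =>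
  not_semilocalSoninIneqOn_two_of_bdd_witness_one hGm hM hGb hb hab hb2 hGc hfin h1 h0 hev hvan hε hdε hd0 hdη
    hB hG hN hC hC0 hK hineq (h.mono haa')

end Summit.RiemannHypothesis.RiemannHypothesis
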